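import Summits.HodgeConjecture.HodgeConjecture.Theorems.LinearSystemTorelliMiddleDivisorSupportFourfoldOfDominantEnvelope
import Summits.HodgeConjecture.HodgeConjecture.Theses.PeriodDeficiency
import Literature.AlgebraicGeometry.HodgeTheory.HodgeGenericQbarDescentCompactification
import Literature.AlgebraicGeometry.HodgeTheory.AlgebraicCyclesDefinedOverQbar

/-!
# Route `LinearSystemTorelli` — crux `MiddleDivisorSupportFourfold` (stmt-HodgeConjecture-2409)
# over `ℚ̄`: dominant `ℚ̄`-envelope ∧ HC over `ℚ̄` in codimension 2 ⟹ crux, modulo Hilbert schemes only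

Helper file for the crux item stmt-HodgeConjecture-2409 (`--supports`; it closes nothing), line
`IdeatorFiveSketch` (idea `weakly-nonfactor-descent`), lead c2. Companion of
`LinearSystemTorelliMiddleDivisorSupportFourfoldOfDominantEnvelope` (number-field models, glue
lemmas `linearSystemTorelli_map_mem_supportedClasses_one_of_preimage_ne_univ`,
`linearSystemTorelli_preimage_ne_univ_of_denseRange`), written over `ℚ̄ = AlgebraicClosure ℚ` with a
FIXED embedding `σ : ℚ̄ →+* ℂ` — the spelling of route `PeriodDeficiency` (`HodgeConjectureQbar`,
stmt-11596) and of the Literature story `HodgeGenericQbarDescent` — so that the sector half of the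
line dedups against a third route verbatim:

* `linearSystemTorelli_middleDivisorSupportFourfold_of_dominantQbarEnvelope` (registered sub-goal):
  DominantQbarEnvelope(4,2) ∧ QbarDivisorSupport(·,2) ⟹ crux, glue PROVED (no cycle class, no
  moving lemma, no `fulton1998_map_mem_algebraicClasses`);
* `linearSystemTorelli_dominantQbarEnvelope_of_baseChange`: the dominant envelope exists trivially
  for `ℚ̄`-definable fourfolds (non-vacuity; the content is the transcendental case);
* `linearSystemTorelli_qbarDivisorSupport_of_hodgeConjectureQbar`: QbarDivisorSupport(·,2) ⟸
  `PeriodDeficiency.HodgeConjectureQbar` (codimension-2 slice) granted the named fact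
  `charlesSchnell2014_algebraicClasses_supportedOn_qbarClosed` (Charles–Schnell 2014, Remark after
  Cor. 11.3.16: cycles on `X₀ ⊗ ℂ` are algebraically equivalent to `ℚ̄`-cycles — Hilbert schemes
  over `ℚ̄`, `ℚ̄`-points dense; stated inline, relocated by the gate under `Literature/`);
* `linearSystemTorelli_middleDivisorSupportFourfold_of_dominantQbarEnvelope_of_hodgeConjectureQbar`:
  **stmt-2409 ⟸ DominantQbarEnvelope(4,2) ∧ stmt-11596 modulo that remark** — fields of definition
  of cycles (Hilbert schemes) instead of intersection theory (Fulton Cor. 19.2 (b)).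

The two hypotheses are each implied by the crux modulo classical theorems (spread of algebraic
cycles; the remark) and neither alone is known to give it; nothing here restates the crux.
-/

noncomputable section

/-! ### Named fact stated inline (relocated by the gate under `Literature/`) -/

namespace Literature.AlgebraicGeometry.HodgeTheory

open CategoryTheory AlgebraicGeometry
open Literature.AlgebraicGeometry.Motives

end Literature.AlgebraicGeometry.HodgeTheory

namespace Summit.HodgeConjecture.HodgeConjecture.Theorems

open CategoryTheory AlgebraicGeometry
open Literature.AlgebraicGeometry Literature.AlgebraicGeometry.HodgeTheory
open Literature.AlgebraicGeometry.Motives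

/-- In an irreducible scheme (e.g. a `ℚ̄`-model), a subset all of whose points have codimension
`≥ r ≥ 1` is proper: it misses the generic point (codimension `0`). [cite: Hartshorne1977, II Ex. 3.20] -/
theorem linearSystemTorelli_ne_univ_of_forall_le_coheight_of_irreducibleSpace {T : Scheme}
    [IrreducibleSpace ↥T] {S : Set ↥T} {r : ℕ} (hr : 1 ≤ r)
    (hcoh : ∀ z ∈ S, (r : ℕ∞) ≤ Order.coheight z) : S ≠ Set.univ := by
  intro hS
  have h := hcoh (genericPoint T) (hS.symm ▸ Set.mem_univ _)
  have hmax : IsMax (genericPoint T) := fun z _ ↦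
    Scheme.le_iff_specializes.2 ((genericPoint_spec T).specializes (Set.mem_univ z))
  rw [Order.coheight_eq_zero.2 hmax] at h
  have h1 : ((1 : ℕ) : ℕ∞) ≤ (r : ℕ∞) := by exact_mod_cast hr
  exact absurd (h1.trans h) (by simp)

/-- **DominantQbarEnvelope(4,2) ∧ QbarDivisorSupport(·,2) ⟹ crux**, for a fixed `σ : ℚ̄ →+* ℂ`.
TRANSFER (sharpened): every rational `(2,2)`-class `c` on a smooth projective complex fourfold `X` is
`ι^* c'` for a `ℂ`-morphism `ι : X ⟶ W₀ ⊗_{ℚ̄,σ} ℂ`, `W₀` a `ℚ̄`-scheme with smooth projective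
complexification, `X → W₀` DOMINANT, `c'` a rational `(2,2)`-class (the output of Charles–Schnell
Thm 11.3.19 over the `ℚ̄`-Zariski closure of the moduli point). SECTOR (divisor support with
`ℚ̄`-rational support): every rational `(2,2)`-class on every smooth projective `W₀ ⊗_{ℚ̄,σ} ℂ` dies
off `π⁻¹ Z₀` for some proper Zariski-closed `Z₀ ⊊ W₀`. Glue: `ι^* c'` dies off `ι⁻¹ π⁻¹ Z₀`, a
proper closed subset of the integral fourfold — no intersection theory.
[cite: CharlesSchnell2014Notes, Thm 11.3.19] [cite: Voisin2007HodgeLoci, Prop. 1.7]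
[cite: GrothendieckTopology1969, §1] -/
theorem linearSystemTorelli_middleDivisorSupportFourfold_of_dominantQbarEnvelope :
    ∀ (σ : AlgebraicClosure ℚ →+* ℂ),
    (∀ ⦃X : SchemeOver ℂ⦄, IsSmoothProjective 4 X → ∀ (c : complexBetti X 4), IsRationalClass c →
      IsOfHodgeType 4 X 4 2 2 c →
        ∃ (m : ℕ) (W₀ : SchemeOver (AlgebraicClosure ℚ)) (ι : X ⟶ (baseChangeHom σ).obj W₀)
          (c' : complexBetti ((baseChangeHom σ).obj W₀) 4),
          IsSmoothProjective m ((baseChangeHom σ).obj W₀) ∧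
          DenseRange (ι.left ≫ baseChangeHomFst σ W₀).base ∧
          IsRationalClass c' ∧ IsOfHodgeType m ((baseChangeHom σ).obj W₀) 4 2 2 c' ∧
          complexBetti.map ι 4 c' = c) →
    (∀ ⦃m : ℕ⦄ (W₀ : SchemeOver (AlgebraicClosure ℚ)), IsSmoothProjective m ((baseChangeHom σ).obj W₀) →
      ∀ (c' : complexBetti ((baseChangeHom σ).obj W₀) 4), IsRationalClass c' →
        IsOfHodgeType m ((baseChangeHom σ).obj W₀) 4 2 2 c' →
          ∃ Z₀ : Set W₀.left, IsClosed Z₀ ∧ Z₀ ≠ Set.univ ∧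
            complexBetti.restrictCompl ((baseChangeHom σ).obj W₀)
              ((baseChangeHomFst σ W₀).base ⁻¹' Z₀) 4 c' = 0) →
    Theses.LinearSystemTorelli.MiddleDivisorSupportFourfold := by
  intro σ hE hQ X hX c hc hh
  obtain ⟨m, W₀, ι, c', hW, hdom, hc', hh', hmap⟩ := hE hX c hc hh
  obtain ⟨Z₀, hZ₀, hZ₀ne, hd⟩ := hQ W₀ hW c' hc' hh'
  rw [← hmap]
  -- `ι⁻¹(π⁻¹ Z₀) = (ι ≫ π)⁻¹ Z₀` definitionally (`Scheme.comp_base` is `rfl`)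
  exact linearSystemTorelli_map_mem_supportedClasses_one_of_preimage_ne_univ hX ι
    (hZ₀.preimage (baseChangeHomFst σ W₀).continuous)
    (linearSystemTorelli_preimage_ne_univ_of_denseRange hdom hZ₀ hZ₀ne) hd

/-- **The dominant `ℚ̄`-envelope exists trivially for `ℚ̄`-definable fourfolds** (non-vacuity of the
TRANSFER hypothesis; its content is the transcendental case): for `X = X₀ ⊗_{ℚ̄,σ} ℂ` itself,
`(4, X₀, 𝟙 X, c)` is a dominant envelope of any class `c` — `π : X₀ ⊗ ℂ → X₀` is onto
(`surjective_baseChangeHomFst`), hence has dense range. [cite: Voisin2007HodgeLoci, Rem. 1.4] -/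
theorem linearSystemTorelli_dominantQbarEnvelope_of_baseChange (σ : AlgebraicClosure ℚ →+* ℂ)
    {X₀ : SchemeOver (AlgebraicClosure ℚ)} (hX : IsSmoothProjective 4 ((baseChangeHom σ).obj X₀))
    (c : complexBetti ((baseChangeHom σ).obj X₀) 4) (hc : IsRationalClass c)
    (hh : IsOfHodgeType 4 ((baseChangeHom σ).obj X₀) 4 2 2 c) :
    ∃ (m : ℕ) (W₀ : SchemeOver (AlgebraicClosure ℚ))
      (ι : (baseChangeHom σ).obj X₀ ⟶ (baseChangeHom σ).obj W₀)
      (c' : complexBetti ((baseChangeHom σ).obj W₀) 4),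
      IsSmoothProjective m ((baseChangeHom σ).obj W₀) ∧
      DenseRange (ι.left ≫ baseChangeHomFst σ W₀).base ∧
      IsRationalClass c' ∧ IsOfHodgeType m ((baseChangeHom σ).obj W₀) 4 2 2 c' ∧
      complexBetti.map ι 4 c' = c := by
  refine ⟨4, X₀, 𝟙 _, c, hX, ?_, hc, hh, by simp⟩
  have h : DenseRange (baseChangeHomFst σ X₀).base :=
    (surjective_baseChangeHomFst σ X₀).surj.denseRange
  simpa using h

/-- **QbarDivisorSupport(·,2) ⟸ HC over `ℚ̄` in codimension 2, granted Charles–Schnell's remark.**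
For a fixed `σ`: if rational `(2,2)`-classes on every smooth projective `W₀ ⊗_{ℚ̄,σ} ℂ` are algebraic
(the codimension-2 slice of `PeriodDeficiency.HodgeConjectureQbar`, stmt-11596, and of the bracketed
hypothesis of `voisin2007_algebraic_of_finite_monodromyOrbit_of_qbar`), then by the named fact each
such class dies off `π⁻¹ Z₀`, `Z₀ ⊆ W₀` Zariski-closed of codimension `≥ 2`, which is proper because
`W₀` is irreducible (`irreducibleSpace_of_irreducibleSpace_baseChangeHom_obj`) and its generic point
has codimension `0`. [cite: CharlesSchnell2014Notes, Cor. 11.3.16 and the Remark following it] -/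
theorem linearSystemTorelli_qbarDivisorSupport_of_hcQbarCodimTwo
    (hF : Literature.AlgebraicGeometry.HodgeTheory.charlesSchnell2014_algebraicClasses_supportedOn_qbarClosed) (σ : AlgebraicClosure ℚ →+* ℂ)
    (hQ : ∀ ⦃m : ℕ⦄ ⦃W₀ : SchemeOver (AlgebraicClosure ℚ)⦄,
      IsSmoothProjective m ((baseChangeHom σ).obj W₀) →
        ∀ (c' : complexBetti ((baseChangeHom σ).obj W₀) 4), IsRationalClass c' →
          IsOfHodgeType m ((baseChangeHom σ).obj W₀) 4 2 2 c' →
            c' ∈ algebraicClasses ((baseChangeHom σ).obj W₀) 2) :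
    ∀ ⦃m : ℕ⦄ (W₀ : SchemeOver (AlgebraicClosure ℚ)), IsSmoothProjective m ((baseChangeHom σ).obj W₀) →
      ∀ (c' : complexBetti ((baseChangeHom σ).obj W₀) 4), IsRationalClass c' →
        IsOfHodgeType m ((baseChangeHom σ).obj W₀) 4 2 2 c' →
          ∃ Z₀ : Set W₀.left, IsClosed Z₀ ∧ Z₀ ≠ Set.univ ∧
            complexBetti.restrictCompl ((baseChangeHom σ).obj W₀)
              ((baseChangeHomFst σ W₀).base ⁻¹' Z₀) 4 c' = 0 := by
  intro m W₀ hW c' hc' hh'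
  obtain ⟨Z₀, hZ₀, hcoh, hd⟩ := hF σ W₀ hW 2 c' (hQ hW c' hc' hh')
  haveI := irreducibleSpace_of_isSmoothProjective' hW
  haveI := irreducibleSpace_of_irreducibleSpace_baseChangeHom_obj σ W₀
  exact ⟨Z₀, hZ₀,
    linearSystemTorelli_ne_univ_of_forall_le_coheight_of_irreducibleSpace (by norm_num) hcoh, hd⟩

/-- **QbarDivisorSupport(·,2) ⟸ `PeriodDeficiency.HodgeConjectureQbar` (stmt-11596), granted the
remark** (its codimension-2 slice is `hQ` above). [cite: CharlesSchnell2014Notes, Cor. 11.3.16 and the Remark following it] -/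
theorem linearSystemTorelli_qbarDivisorSupport_of_hodgeConjectureQbar
    (hF : Literature.AlgebraicGeometry.HodgeTheory.charlesSchnell2014_algebraicClasses_supportedOn_qbarClosed)
    (h : Theses.PeriodDeficiency.HodgeConjectureQbar) (σ : AlgebraicClosure ℚ →+* ℂ) :
    ∀ ⦃m : ℕ⦄ (W₀ : SchemeOver (AlgebraicClosure ℚ)), IsSmoothProjective m ((baseChangeHom σ).obj W₀) →
      ∀ (c' : complexBetti ((baseChangeHom σ).obj W₀) 4), IsRationalClass c' →
        IsOfHodgeType m ((baseChangeHom σ).obj W₀) 4 2 2 c' →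
          ∃ Z₀ : Set W₀.left, IsClosed Z₀ ∧ Z₀ ≠ Set.univ ∧
            complexBetti.restrictCompl ((baseChangeHom σ).obj W₀)
              ((baseChangeHomFst σ W₀).base ⁻¹' Z₀) 4 c' = 0 :=
  linearSystemTorelli_qbarDivisorSupport_of_hcQbarCodimTwo hF σ
    fun _ _ hW c' hc' hh' ↦ (h σ hW).2 2 c' hc' hh'

/-- **stmt-2409 ⟸ DominantQbarEnvelope(4,2) ∧ HC over `ℚ̄` (stmt-11596), modulo the Charles–Schnell
remark** — no intersection theory: dominant `ℚ̄`-envelope, HC over `ℚ̄` in codimension 2 upstairs,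
`ℚ̄`-rational support (the named fact), pull-back of the complement along the dominant map.
[cite: CharlesSchnell2014Notes, Thm 11.3.19 and Remark after Cor. 11.3.16] [cite: Voisin2007HodgeLoci, Prop. 1.7] -/
theorem linearSystemTorelli_middleDivisorSupportFourfold_of_dominantQbarEnvelope_of_hodgeConjectureQbar
    (hF : Literature.AlgebraicGeometry.HodgeTheory.charlesSchnell2014_algebraicClasses_supportedOn_qbarClosed)
    (h : Theses.PeriodDeficiency.HodgeConjectureQbar) (σ : AlgebraicClosure ℚ →+* ℂ)
    (hE : ∀ ⦃X : SchemeOver ℂ⦄, IsSmoothProjective 4 X → ∀ (c : complexBetti X 4),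
      IsRationalClass c → IsOfHodgeType 4 X 4 2 2 c →
        ∃ (m : ℕ) (W₀ : SchemeOver (AlgebraicClosure ℚ)) (ι : X ⟶ (baseChangeHom σ).obj W₀)
          (c' : complexBetti ((baseChangeHom σ).obj W₀) 4),
          IsSmoothProjective m ((baseChangeHom σ).obj W₀) ∧
          DenseRange (ι.left ≫ baseChangeHomFst σ W₀).base ∧
          IsRationalClass c' ∧ IsOfHodgeType m ((baseChangeHom σ).obj W₀) 4 2 2 c' ∧
          complexBetti.map ι 4 c' = c) :
    Theses.LinearSystemTorelli.MiddleDivisorSupportFourfold :=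
  linearSystemTorelli_middleDivisorSupportFourfold_of_dominantQbarEnvelope σ hE
    (linearSystemTorelli_qbarDivisorSupport_of_hodgeConjectureQbar hF h σ)

end Summit.HodgeConjecture.HodgeConjecture.Theorems

end
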